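import Mathlib
import Summits.KontsevichZagierPeriods.Zeta5Search.OriginWindowClasses
import Summits.KontsevichZagierPeriods.Zeta5Search.CellKitRays
import Summits.KontsevichZagierPeriods.Zeta5Search.CellKitAffine
import HarnessLib

/-!
# ζ(5) search — RAY #4 of the T1 map: the ORIGIN window `M = 8` (`15n < 2p ≤ 16n`), typed for the atlas machine (HONEST FRAMING: systematic search; no irrationality claim unless certified)

Cell `pub-zeta5`, GEN-2 seat generation 16.  Ray #4 of the census T1 map (g8 class #4, `a = (7,13,9,12,11,15,17,12)`,
`β = (34; 14,13,12,11,10,9,8)`, `d = 25`) is the linear ray `b(n) = bLin (8n) (6n) n` of `CellKitRays`; by the census window atlas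
(`xsave/g22/atlas/atlas_H1_g8c4.md`) its single largest type-space window is the ORIGIN window `θ = p/n ∈ (15/2, 8]`
(`0.500` nats/step of denominator: exponent `4 → 3`, the BZ-exact value there).  This file TYPES that window in the format of
`OriginWindowData.lean` (record windows `M = 12, 28`):

* `linWindow_of_classes` — the generic origin-window reduction of `OriginWindowClasses.bound_of_classes` on ANY linear ray `bLin a e n`
  (polytope, shift, `b₀ = 2a + 12n + e`, DEG through `Σ_x E_x = −(2d + 5)`, `d = 15n + 3e − a`), the `bLin` analogue of
  `OriginWindows.recWindow_of_classes`;
* the window's type inventory (gen-2 g16 `ray4scan.py`, exact port of the tree definitions via census `typepoints.py`; every prime of the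
  window with `n ≤ 300`): `M = 8`, deep types `D8` (one palindrome + one conjugate pair), centre-free sub-deep types `S8` (two conjugate
  pairs), no centre types (`b₀ = 34n` is even and no centre class is sub-deep), line direction `u8 = (33, −49)`, constant `c8 = −174`
  (three point values `(18, −32)`, `(−48, 66)`, `(84, −130)` on `49 W + 33 V = −174`);
* EVERY rational identity of `LineData u8 c8 D8 S8 P8` PROVED (`TypeEval` mirror, `decide +kernel`; 10 identities), `lineData8`;
* the class-structure statement `Ray4OriginClassesO8` (`@[conjecture]`: integer bookkeeping of `netExp` along residue classes, to be
  discharged uniformly by the atlas machine as for `OriginWindowM12*.lean`) and the PROVED reduction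
  `ray4WindowO8_of : Ray4OriginClassesO8 → Ray4WindowO8`, where `Ray4WindowO8` is the window bound `v_p(Cas₇(b(n))) ≥ −11 = 5 − 2M`.

`p`-adic bookkeeping of rational numbers; nothing here bears on irrationality.
-/

noncomputable section

open Finset

namespace Summit.KontsevichZagierPeriods.Zeta5Search.Ray4Windows

open Summit.KontsevichZagierPeriods.Zeta5Search.CasoratianValuation (InPolytope shift casoratian)
open Summit.KontsevichZagierPeriods.Zeta5Search.ClusterValuation
open Summit.KontsevichZagierPeriods.Zeta5Search.SecondOrder
open Summit.KontsevichZagierPeriods.Zeta5Search.ResidueLaw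
open Summit.KontsevichZagierPeriods.Zeta5Search.WedgeDictionary (dOf)
open Summit.KontsevichZagierPeriods.Zeta5Search.LevelClass (typeW typeV)
open Summit.KontsevichZagierPeriods.Zeta5Search.CellKit (bLin bLin_zero bLin_succ inPolytope_bLin inPolytope_shift_bLin)
open Summit.KontsevichZagierPeriods.Zeta5Search.ZeroWindows (deepPoint pairPoint)
open Summit.KontsevichZagierPeriods.Zeta5Search.OriginWindows
open Summit.KontsevichZagierPeriods.Zeta5Search.TypeEval (typeRho_eq_typeRhoC)

variable {p : ℕ} [hp : Fact p.Prime]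

/-! ## §1 The generic origin-window reduction on a linear ray `bLin a e n` -/

-- lane edit (lead/lit g13, dedup.landed): the local re-proof of `CellKit.dOf_bLin` (CellKitAffine.lean) was deleted;
-- that module is now imported and the tree lemma is used below.

/-- DEG on a linear ray: `Σ_{x<p} E_x = −(2d + 5)` with `d = 15n + 3e − a`, so DEG ⟺ `p(M − 2) ≤ 2d + 1`. -/
theorem deg_bLin {a e n : ℕ} (M : ℕ) (ha : a ≤ 15 * n + 3 * e) (h5 : 5 ≤ p)
    (h : (p : ℤ) * ((M : ℤ) - 2) ≤ 2 * (15 * (n : ℤ) + 3 * e - a) + 1) :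
    (p : ℤ) * ((M : ℤ) - 2) + ∑ x ∈ range p, classExp (bLin a e n) p x ≤ -4 := by
  rw [sum_classExp_range (bLin a e n) (inPolytope_bLin ha) h5, CellKit.dOf_bLin]; omega

omit hp in
/-- **The generic origin-window reduction on a linear ray** (`bound_of_classes` with the polytope, shift, `b₀` and DEG facts of `bLin a e n`):
class structure `OriginWindowClasses` + line data `LineData (u, c)` on a window with `5 ≤ p ≤ b₀ < p² − 2`, `M ≥ 6` even and
`p(M − 2) ≤ 2d + 1` give `v_p(Cas₇(bLin a e n)) ≥ 5 − 2M`. -/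
theorem linWindow_of_classes (a e n p' M : ℕ) (D S P : List (List ℤ)) (u : ℤ × ℤ) (c : ℚ) (hn : 1 ≤ n) (ha : a + 1 ≤ 15 * n + 3 * e)
    (hp' : p'.Prime) (h5 : 5 ≤ p') (hpn : p' ≤ 2 * a + 12 * n + e) (hp2 : 2 * a + 12 * n + e + 2 < p' ^ 2) (hM : 6 ≤ M) (hMe : Even M)
    (hdeg : (p' : ℤ) * ((M : ℤ) - 2) ≤ 2 * (15 * (n : ℤ) + 3 * e - a) + 1)
    (hu : ¬ ((p' : ℤ) ∣ u.1 ∧ (p' : ℤ) ∣ u.2)) (hI : LineData u c D S P) (hC : OriginWindowClasses (bLin a e n) p' M D S P)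
    (hne : casoratian (bLin a e n) 7 ≠ 0) : (5 : ℤ) - 2 * M ≤ padicValRat p' (casoratian (bLin a e n) 7) := by
  haveI : Fact p'.Prime := ⟨hp'⟩
  have hpb : (p' : ℤ) ≤ bLin a e n 0 := by rw [bLin_zero]; exact_mod_cast hpn
  have hp2' : (bLin a e n 0 + 2 : ℤ) < (p' : ℤ) ^ 2 := by rw [bLin_zero]; exact_mod_cast hp2
  exact bound_of_classes (bLin a e n) 7 M D S P u c (inPolytope_bLin (by omega)) (inPolytope_shift_bLin hn ha)
    (by norm_num) (by norm_num) h5 hpb hp2' hM hMe hu (deg_bLin M (by omega) h5 hdeg) hC hI hne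

/-! ## §2 Ray #4, origin window `M = 8` (`15n < 2p`, `p ≤ 8n`): type inventory and PROVED line data -/

/-- `M = 8`, `θ ∈ (15/2, 8]`: deep types (one palindrome, one conjugate pair). -/
def D8 : List (List ℤ) := [[1, -6, -4, 1], [1, -5, -5, 1], [1, -4, -6, 1]]
/-- `M = 8`: centre-free sub-deep types (two conjugate pairs). -/
def S8 : List (List ℤ) := [[1, -6, -3, 1], [1, -5, -4, 1], [1, -4, -5, 1], [1, -3, -6, 1]]
/-- `M = 8`: no centre types (`b₀ = 34n` is even). -/
def P8 : List (List ℤ) := []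
/-- `M = 8`: primitive direction of the line of orbit points (gen-2 g16 `ray4scan.py`). -/
def u8 : ℤ × ℤ := (33, -49)
/-- `M = 8`: the constant `Φ_u` along the line (`49 W + 33 V = −174`). -/
def c8 : ℚ := -174

set_option maxHeartbeats 8000000 in
/-- Line datum (`M = 8`): deep type 1, its exact orbit vector is `∥ u8`. -/
theorem d8_dir_1 : lineVal u8 (dirVec [1, -6, -4, 1]) = 0 := by
  unfold lineVal dirVec LevelClass.typeW LevelClass.typeV; simp only [typeRho_eq_typeRhoC]; decide +kernel

set_option maxHeartbeats 8000000 in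
/-- Line datum (`M = 8`): deep type 1, its doubled orbit point has `Φ_u = c8`. -/
theorem d8_pt_1 : lineVal u8 (deepPt [1, -6, -4, 1]) = c8 := by
  unfold lineVal deepPt typeTauW typeTauV typeW2 typeV2 LevelClass.typeW LevelClass.typeV; simp only [typeRho_eq_typeRhoC]; decide +kernel

set_option maxHeartbeats 8000000 in
/-- Line datum (`M = 8`): deep type 2 (the palindrome), its exact orbit vector vanishes. -/
theorem d8_dir_2 : lineVal u8 (dirVec [1, -5, -5, 1]) = 0 := by
  unfold lineVal dirVec LevelClass.typeW LevelClass.typeV; simp only [typeRho_eq_typeRhoC]; decide +kernel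

set_option maxHeartbeats 8000000 in
/-- Line datum (`M = 8`): deep type 2, its doubled orbit point has `Φ_u = c8`. -/
theorem d8_pt_2 : lineVal u8 (deepPt [1, -5, -5, 1]) = c8 := by
  unfold lineVal deepPt typeTauW typeTauV typeW2 typeV2 LevelClass.typeW LevelClass.typeV; simp only [typeRho_eq_typeRhoC]; decide +kernel

set_option maxHeartbeats 8000000 in
/-- Line datum (`M = 8`): deep type 3, its exact orbit vector is `∥ u8`. -/
theorem d8_dir_3 : lineVal u8 (dirVec [1, -4, -6, 1]) = 0 := by
  unfold lineVal dirVec LevelClass.typeW LevelClass.typeV; simp only [typeRho_eq_typeRhoC]; decide +kernel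

set_option maxHeartbeats 8000000 in
/-- Line datum (`M = 8`): deep type 3, its doubled orbit point has `Φ_u = c8`. -/
theorem d8_pt_3 : lineVal u8 (deepPt [1, -4, -6, 1]) = c8 := by
  unfold lineVal deepPt typeTauW typeTauV typeW2 typeV2 LevelClass.typeW LevelClass.typeV; simp only [typeRho_eq_typeRhoC]; decide +kernel

set_option maxHeartbeats 8000000 in
/-- Line datum (`M = 8`): sub-deep type 1, its pair point has `Φ_u = c8`. -/
theorem s8_pt_1 : lineVal u8 (pairPoint [1, -6, -3, 1]) = c8 := by
  unfold lineVal ZeroWindows.pairPoint LevelClass.typeW LevelClass.typeV; simp only [typeRho_eq_typeRhoC]; decide +kernel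

set_option maxHeartbeats 8000000 in
/-- Line datum (`M = 8`): sub-deep type 2, its pair point has `Φ_u = c8`. -/
theorem s8_pt_2 : lineVal u8 (pairPoint [1, -5, -4, 1]) = c8 := by
  unfold lineVal ZeroWindows.pairPoint LevelClass.typeW LevelClass.typeV; simp only [typeRho_eq_typeRhoC]; decide +kernel

set_option maxHeartbeats 8000000 in
/-- Line datum (`M = 8`): sub-deep type 3, its pair point has `Φ_u = c8`. -/
theorem s8_pt_3 : lineVal u8 (pairPoint [1, -4, -5, 1]) = c8 := by
  unfold lineVal ZeroWindows.pairPoint LevelClass.typeW LevelClass.typeV; simp only [typeRho_eq_typeRhoC]; decide +kernel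

set_option maxHeartbeats 8000000 in
/-- Line datum (`M = 8`): sub-deep type 4, its pair point has `Φ_u = c8`. -/
theorem s8_pt_4 : lineVal u8 (pairPoint [1, -3, -6, 1]) = c8 := by
  unfold lineVal ZeroWindows.pairPoint LevelClass.typeW LevelClass.typeV; simp only [typeRho_eq_typeRhoC]; decide +kernel

/-- **The line data of the ray-#4 `M = 8` window HOLD.** -/
theorem lineData8 : LineData u8 c8 D8 S8 P8 := by
  refine ⟨?_, ?_, ?_⟩
  · intro T hT
    simp only [D8, List.mem_cons, List.not_mem_nil, or_false] at hT
    rcases hT with rfl | rfl | rfl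
    · exact ⟨d8_dir_1, d8_pt_1⟩
    · exact ⟨d8_dir_2, d8_pt_2⟩
    · exact ⟨d8_dir_3, d8_pt_3⟩
  · intro s hs
    simp only [S8, List.mem_cons, List.not_mem_nil, or_false] at hs
    rcases hs with rfl | rfl | rfl | rfl
    · exact s8_pt_1
    · exact s8_pt_2
    · exact s8_pt_3
    · exact s8_pt_4
  · intro T hT
    simp [P8] at hT

omit hp in
/-- `u8` is primitive, so never `≡ 0 (mod p)`. -/
theorem u8_ne (hq : p.Prime) : ¬ ((p : ℤ) ∣ u8.1 ∧ (p : ℤ) ∣ u8.2) := by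
  rintro ⟨h1, h2⟩
  have h := Int.dvd_gcd h1 h2
  rw [show Int.gcd u8.1 u8.2 = 1 by decide +kernel] at h
  exact hq.one_lt.ne' (Nat.dvd_one.1 (by exact_mod_cast h))

/-! ## §3 The window statements and the reduction -/

/-- **RAY-#4 WINDOW `M = 8`** (`15/2 < θ ≤ 8`; origin regime, `casLB + 2`): `v_p(Cas₇(bLin (8n) (6n) n)) ≥ −11 = 5 − 2M`
(census atlas: exponent `4 → 3` = the BZ-exact value on this window, `0.500` nats/step). -/
@[conjecture] def Ray4WindowO8 : Prop :=
  ∀ n p : ℕ, 2 ≤ n → p.Prime → 15 * n < 2 * p → p ≤ 8 * n → casoratian (bLin (8 * n) (6 * n) n) 7 ≠ 0 →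
    (-11 : ℤ) ≤ padicValRat p (casoratian (bLin (8 * n) (6 * n) n) 7)

/-- **CLASS STRUCTURE, ray-#4 origin window `M = 8`** (`15n < 2p`, `p ≤ 8n`).  gen-2 g16 `ray4scan.py`: every prime of the window with
`n ≤ 300`, 0 exceptions — to be discharged uniformly by the atlas machine (as `OriginWindowM12*.lean` for the record ray). -/
@[conjecture] def Ray4OriginClassesO8 : Prop :=
  ∀ n p : ℕ, 2 ≤ n → p.Prime → 15 * n < 2 * p → p ≤ 8 * n → OriginWindowClasses (bLin (8 * n) (6 * n) n) p 8 D8 S8 P8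

omit hp in
/-- **`Ray4WindowO8` from its class structure** (the line data being PROVED). -/
theorem ray4WindowO8_of (hC : Ray4OriginClassesO8) : Ray4WindowO8 := by
  intro n p hn hp h1 h2 hne
  have h5 : 5 ≤ p := by omega
  have hp2 : 2 * (8 * n) + 12 * n + 6 * n + 2 < p ^ 2 := by nlinarith
  exact linWindow_of_classes (8 * n) (6 * n) n p 8 D8 S8 P8 u8 c8 (by omega) (by omega) hp h5 (by omega) hp2 (by norm_num) (by decide)
    (by push_cast; omega) (u8_ne hp) lineData8 (hC n p hn hp h1 h2) hne

end Summit.KontsevichZagierPeriods.Zeta5Search.Ray4Windows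

end
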